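import Mathlib
import Summits.MatrixMultiplication.MatrixMultiplication.Theorems.SnSubsetDichotomyHyperoctahedralThresholdTwinPairSupply

/-!
# Counting supply of `R`-free twin pre-pairs at some scale — the ℓ² (Cauchy–Schwarz) twin supply, part 2
# (crux `HyperoctahedralThreshold`, stmt-MatrixMultiplication-10883, refutation line, open core `stub_poorRigidCore`;
# siege variation "twins ℓ² argument")

Notation as in part 1 (`…TwinPairSupply`): `x · g := g.foldl (fun v b => μ b v) x`, `TP_R(m)` = number of `R`-free twin
pre-pairs `(z; p, q)` of length `m` (`z` cyclically reduced, `p ≠ q` fixed by `z`, both `z`-trajectories off `R`).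

* `twinPairSupply_raw` — for the `n(n-1) · 2^k` based words `((x, y), g)` (`x ≠ y`, `g` reduced of length `k` with first
  letter `≠ c`) let `D` be those whose two trajectories avoid `R`.  Cauchy–Schwarz for `((x,y),g) ↦ ((x,y),(x·g, y·g))` into
  `(n(n-1))²` slots gives `|D|² ≤ (n(n-1))² (|D| + #collisions)`, and part 1 sorts the collisions by suffix/prefix lengths:
  `|D|² ≤ (n(n-1))² (|D| + Σ_{i<k} Σ_{j<k-i} 3^i 3^j TP_R(2(k-i-j)))`.
* `card_based_le` — the bijection trick (for a fixed word and time the trajectory point is an injective function of the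
  start): `n(n-1) 2^k ≤ |D| + 2 (k+1) 2^k |R| n`.
* `twinPairSupply` — consequently, if `2 ≤ n`, `8 n² ≤ 2^k` and `8 (k+1) |R| ≤ n`, then `∃ m, 1 ≤ m ≤ k ∧ 4^m ≤ 128 · TP_R(2m)`:
  at SOME even scale `2m ≤ 2k` (e.g. `2k = 4⌈log₂ n⌉ + 6`) the `R`-free twin pre-pairs are at least a `1/128` fraction of the
  `4^m + 2` cyclically reduced words of that length.

This is the counting ("ensemble") form of the twin supply of crux NOTES §2 (S-twin) / §11 (`S_ℓ = ½ Σ_z N_z(N_z - 1)`), without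
Ihara–Bass/Kotani–Sunada (the elementary multi-scale substitute asked for in crux NOTES §12.3), and with the forbidden set built
into the Cauchy–Schwarz domain, so that `R`-avoidance is paid at the level of based words (where the bijection trick applies)
and not at the level of closed walks (the supply half of the objection in crux NOTES §C4).  What it does NOT do: bound the
defects (slides / pattern discordance) of these pre-pairs — that is the open atom ((WM)/(AP), crux NOTES §§11–13).  The
pointwise (per-rung) form is the sibling `…TwinSupply`; the same-colour reflection analogue is `…StubSameColourSupply`.
[folklore; this line]
-/

-- the project's summit namespace `Summit.MatrixMultiplication.MatrixMultiplication` repeats a component by design (D-0022)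
set_option linter.dupNamespace false

namespace Summit.MatrixMultiplication.MatrixMultiplication.Theorems.HyperoctahedralThreshold.TwinPairSupply

open Finset

variable {n : ℕ}

/-! ### The supply inequality -/

/-- **Raw supply inequality for `R`-free twin pre-pairs** ("twins by the ℓ² argument").  Let `D` be the set of based words
`((x, y), g)` — `x ≠ y`, `g` reduced of length `k` with first letter `≠ c`, both trajectories avoiding `R`.  Cauchy–Schwarz for
`((x,y),g) ↦ ((x,y),(x·g,y·g))` (into `(n(n-1))²` slots) and the injection `card_collisions_le` of collisions into
(suffix, prefix, `R`-free twin pre-pair) give `|D|² ≤ (n(n-1))² · (|D| + Σ_{i<k} Σ_{j<k-i} 3^i 3^j TP_R(2(k-i-j)))`. [folklore] -/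
theorem twinPairSupply_raw (n k : ℕ) (μ : Fin 3 → Equiv.Perm (Fin n)) (c : Fin 3) (R : Finset (Fin n))
    (hμ : ∀ b, μ b * μ b = 1) :
    (((Finset.univ : Finset (Fin n)).offDiag ×ˢ
        (((Finset.univ : Finset (List.Vector (Fin 3) k)).image (fun v => v.toList)).filter
          (fun g => List.IsChain (· ≠ ·) g ∧ g.head? ≠ some c))).filter
        (fun e => (∀ t : Fin (k + 1), (e.2.take (t : ℕ)).foldl (fun v b => μ b v) e.1.1 ∉ R) ∧
          (∀ t : Fin (k + 1), (e.2.take (t : ℕ)).foldl (fun v b => μ b v) e.1.2 ∉ R))).card ^ 2 ≤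
    ((n * n - n) * (n * n - n)) *
      ((((Finset.univ : Finset (Fin n)).offDiag ×ˢ
        (((Finset.univ : Finset (List.Vector (Fin 3) k)).image (fun v => v.toList)).filter
          (fun g => List.IsChain (· ≠ ·) g ∧ g.head? ≠ some c))).filter
        (fun e => (∀ t : Fin (k + 1), (e.2.take (t : ℕ)).foldl (fun v b => μ b v) e.1.1 ∉ R) ∧
          (∀ t : Fin (k + 1), (e.2.take (t : ℕ)).foldl (fun v b => μ b v) e.1.2 ∉ R))).card +
      ∑ i ∈ Finset.range k, ∑ j ∈ Finset.range (k - i), 3 ^ i * (3 ^ j *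
        (((((Finset.univ : Finset (List.Vector (Fin 3) (2 * (k - i - j)))).image (fun v => v.toList)).filter
          (fun z => List.IsChain (· ≠ ·) (z ++ z))) ×ˢ (Finset.univ : Finset (Fin n)).offDiag).filter
        (fun e => e.1.foldl (fun v b => μ b v) e.2.1 = e.2.1 ∧ e.1.foldl (fun v b => μ b v) e.2.2 = e.2.2 ∧
          (∀ t : Fin (2 * (k - i - j) + 1), (e.1.take (t : ℕ)).foldl (fun v b => μ b v) e.2.1 ∉ R) ∧
          (∀ t : Fin (2 * (k - i - j) + 1), (e.1.take (t : ℕ)).foldl (fun v b => μ b v) e.2.2 ∉ R))).card)) := by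
  -- the domain `D` (R-avoiding based words at off-diagonal ordered pairs)
  set D := (((Finset.univ : Finset (Fin n)).offDiag ×ˢ
        (((Finset.univ : Finset (List.Vector (Fin 3) k)).image (fun v => v.toList)).filter
          (fun g => List.IsChain (· ≠ ·) g ∧ g.head? ≠ some c))).filter
        (fun e => (∀ t : Fin (k + 1), (e.2.take (t : ℕ)).foldl (fun v b => μ b v) e.1.1 ∉ R) ∧
          (∀ t : Fin (k + 1), (e.2.take (t : ℕ)).foldl (fun v b => μ b v) e.1.2 ∉ R))) with hD
  -- the map `Φ ((x,y),g) = ((x,y),(x·g, y·g))` lands in `offDiag × offDiag`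
  set Φ : (Fin n × Fin n) × List (Fin 3) → (Fin n × Fin n) × (Fin n × Fin n) :=
    fun e => (e.1, (e.2.foldl (fun v b => μ b v) e.1.1, e.2.foldl (fun v b => μ b v) e.1.2)) with hΦ
  have hmaps : ∀ e ∈ D, Φ e ∈ (Finset.univ : Finset (Fin n)).offDiag ×ˢ (Finset.univ : Finset (Fin n)).offDiag := by
    intro e he
    rw [hD, Finset.mem_filter, Finset.mem_product] at he
    refine Finset.mem_product.2 ⟨he.1.1, Finset.mem_offDiag.2 ⟨Finset.mem_univ _, Finset.mem_univ _, ?_⟩⟩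
    intro h
    exact (Finset.mem_offDiag.1 he.1.1).2.2 (Supply.foldl_act_injective μ hμ e.2 h)
  have hCS := Supply.card_sq_le_card_mul_card_pairs D _ Φ hmaps
  rw [Finset.card_product, Finset.offDiag_card, Finset.card_univ, Fintype.card_fin] at hCS
  refine hCS.trans (Nat.mul_le_mul_left _ ?_)
  -- pairs with the same image are diagonal or collisions
  set C := (D ×ˢ D).filter (fun q => q.1 ≠ q.2 ∧ q.1.1 = q.2.1 ∧
          q.1.2.foldl (fun v b => μ b v) q.1.1.1 = q.2.2.foldl (fun v b => μ b v) q.2.1.1 ∧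
          q.1.2.foldl (fun v b => μ b v) q.1.1.2 = q.2.2.foldl (fun v b => μ b v) q.2.1.2) with hC
  have hF : (D ×ˢ D).filter (fun q => Φ q.1 = Φ q.2) ⊆ D.diag ∪ C := by
    intro q hq
    rw [Finset.mem_filter] at hq
    rw [Finset.mem_union, Finset.mem_diag]
    by_cases h : q.1 = q.2
    · exact Or.inl ⟨(Finset.mem_product.1 hq.1).1, h⟩
    · have h1 := congrArg Prod.fst hq.2
      have h2 := congrArg (fun w => w.2.1) hq.2
      have h3 := congrArg (fun w => w.2.2) hq.2
      exact Or.inr (Finset.mem_filter.2 ⟨hq.1, h, h1, h2, h3⟩)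
  have hFcard : ((D ×ˢ D).filter (fun q => Φ q.1 = Φ q.2)).card ≤ D.card + C.card := by
    refine (Finset.card_le_card hF).trans ((Finset.card_union_le _ _).trans ?_)
    rw [Finset.diag_card]
  refine hFcard.trans (Nat.add_le_add_left ?_ _)
  -- collisions, sorted by the lengths `i < k` of the longest common suffix and `j < k - i` of the longest common prefix
  have hcover : C ⊆ (Finset.range k).biUnion (fun i => (Finset.range (k - i)).biUnion (fun j => C.filter (fun q =>
      q.1.2.drop (k - i) = q.2.2.drop (k - i) ∧ q.1.2.drop (k - (i + 1)) ≠ q.2.2.drop (k - (i + 1)) ∧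
      q.1.2.take j = q.2.2.take j ∧ q.1.2.take (j + 1) ≠ q.2.2.take (j + 1)))) := by
    intro q hq
    have hq' := hq
    rw [hC, Finset.mem_filter, Finset.mem_product, hD, Finset.mem_filter, Finset.mem_filter, Finset.mem_product,
      Finset.mem_product] at hq'
    obtain ⟨⟨⟨⟨-, hg₁⟩, -⟩, ⟨-, hg₂⟩, -⟩, hne, hpair, -, -⟩ := hq'
    rw [Finset.mem_filter, Supply.mem_words] at hg₁ hg₂
    have hgne : q.1.2 ≠ q.2.2 := by
      intro hg
      exact hne (Prod.ext hpair hg)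
    obtain ⟨i, hik, hPi, hnP⟩ := Supply.exists_step (P := fun j => q.1.2.drop (k - j) = q.2.2.drop (k - j)) k
      (by
        show q.1.2.drop (k - 0) = q.2.2.drop (k - 0)
        rw [Nat.sub_zero, List.drop_of_length_le (by rw [hg₁.1]), List.drop_of_length_le (by rw [hg₂.1])])
      (by
        show ¬ q.1.2.drop (k - k) = q.2.2.drop (k - k)
        rwa [Nat.sub_self, List.drop_zero, List.drop_zero])
    have hlast := last_ne_of_suffix hg₁.1 hg₂.1 hPi hnP
    obtain ⟨j, hjk, hPj, hnPj⟩ := Supply.exists_step (P := fun j => q.1.2.take j = q.2.2.take j) (k - i)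
      (by show q.1.2.take 0 = q.2.2.take 0; rw [List.take_zero, List.take_zero])
      (by
        show ¬ q.1.2.take (k - i) = q.2.2.take (k - i)
        intro h
        have hl : (q.1.2.take (k - i)).length = k - i := by rw [List.length_take, hg₁.1]; omega
        obtain ⟨x, hx⟩ := List.getLast?_isSome.2 (List.ne_nil_of_length_pos (by rw [hl]; omega)) |>
          Option.isSome_iff_exists.1
        exact hlast x hx x (by rw [← h]; exact hx) rfl)
    exact Finset.mem_biUnion.2 ⟨i, Finset.mem_range.2 hik, Finset.mem_biUnion.2
      ⟨j, Finset.mem_range.2 hjk, Finset.mem_filter.2 ⟨hq, hPi, hnP, hPj, hnPj⟩⟩⟩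
  refine (Finset.card_le_card hcover).trans (Finset.card_biUnion_le.trans ?_)
  refine Finset.sum_le_sum (fun i hi => Finset.card_biUnion_le.trans (Finset.sum_le_sum (fun j hj => ?_)))
  exact card_collisions_le μ hμ c R k i j (Finset.mem_range.1 hi) (Finset.mem_range.1 hj)

/-- **Cost of `R`-avoidance at the level of based words** (bijection trick).  All `n(n-1) · 2^k` based words except at most
`2 (k+1) 2^k |R| n` have both trajectories off `R`: for a fixed word `g` and time `t`, `((x,y),g) ↦ (g, (x · g.take t, y))` is
injective, so the based words whose `x`-trajectory is in `R` at time `t` number `≤ 2^k |R| n`. [folklore] -/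
theorem card_based_le (n k : ℕ) (μ : Fin 3 → Equiv.Perm (Fin n)) (c : Fin 3) (R : Finset (Fin n))
    (hμ : ∀ b, μ b * μ b = 1) :
    (n * n - n) * 2 ^ k ≤
      (((Finset.univ : Finset (Fin n)).offDiag ×ˢ
        (((Finset.univ : Finset (List.Vector (Fin 3) k)).image (fun v => v.toList)).filter
          (fun g => List.IsChain (· ≠ ·) g ∧ g.head? ≠ some c))).filter
        (fun e => (∀ t : Fin (k + 1), (e.2.take (t : ℕ)).foldl (fun v b => μ b v) e.1.1 ∉ R) ∧
          (∀ t : Fin (k + 1), (e.2.take (t : ℕ)).foldl (fun v b => μ b v) e.1.2 ∉ R))).card +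
      2 * ((k + 1) * (2 ^ k * (R.card * n))) := by
  set P := (Finset.univ : Finset (Fin n)).offDiag with hP
  set W := ((Finset.univ : Finset (List.Vector (Fin 3) k)).image (fun v => v.toList)).filter
          (fun g => List.IsChain (· ≠ ·) g ∧ g.head? ≠ some c) with hW
  have hWcard : W.card = 2 ^ k := Supply.card_redWords k c
  have hPW : (P ×ˢ W).card = (n * n - n) * 2 ^ k := by
    rw [Finset.card_product, hP, Finset.offDiag_card, Finset.card_univ, Fintype.card_fin, hWcard]
  -- the bad based words, by the coordinate and the time at which the trajectory is in `R`
  set B₁ : Fin (k + 1) → Finset ((Fin n × Fin n) × List (Fin 3)) := fun t =>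
    (P ×ˢ W).filter (fun e => (e.2.take (t : ℕ)).foldl (fun v b => μ b v) e.1.1 ∈ R) with hB₁
  set B₂ : Fin (k + 1) → Finset ((Fin n × Fin n) × List (Fin 3)) := fun t =>
    (P ×ˢ W).filter (fun e => (e.2.take (t : ℕ)).foldl (fun v b => μ b v) e.1.2 ∈ R) with hB₂
  have hcover : P ×ˢ W ⊆ ((P ×ˢ W).filter
        (fun e => (∀ t : Fin (k + 1), (e.2.take (t : ℕ)).foldl (fun v b => μ b v) e.1.1 ∉ R) ∧
          (∀ t : Fin (k + 1), (e.2.take (t : ℕ)).foldl (fun v b => μ b v) e.1.2 ∉ R))) ∪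
      ((Finset.univ : Finset (Fin (k + 1))).biUnion B₁ ∪ (Finset.univ : Finset (Fin (k + 1))).biUnion B₂) := by
    intro e he
    rw [Finset.mem_union, Finset.mem_union, Finset.mem_filter, Finset.mem_biUnion, Finset.mem_biUnion]
    by_cases h₁ : ∀ t : Fin (k + 1), (e.2.take (t : ℕ)).foldl (fun v b => μ b v) e.1.1 ∉ R
    · by_cases h₂ : ∀ t : Fin (k + 1), (e.2.take (t : ℕ)).foldl (fun v b => μ b v) e.1.2 ∉ R
      · exact Or.inl ⟨he, h₁, h₂⟩
      · simp only [not_forall, not_not] at h₂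
        obtain ⟨t, ht⟩ := h₂
        exact Or.inr (Or.inr ⟨t, Finset.mem_univ _, Finset.mem_filter.2 ⟨he, ht⟩⟩)
    · simp only [not_forall, not_not] at h₁
      obtain ⟨t, ht⟩ := h₁
      exact Or.inr (Or.inl ⟨t, Finset.mem_univ _, Finset.mem_filter.2 ⟨he, ht⟩⟩)
  -- each `B₁ t`, `B₂ t` injects into `W × (R × univ)`
  have hc : (W ×ˢ (R ×ˢ (Finset.univ : Finset (Fin n)))).card = 2 ^ k * (R.card * n) := by
    rw [Finset.card_product, Finset.card_product, Finset.card_univ, Fintype.card_fin, hWcard]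
  have hB₁card : ∀ t, (B₁ t).card ≤ 2 ^ k * (R.card * n) := by
    intro t
    rw [← hc]
    refine Finset.card_le_card_of_injOn (fun e => (e.2, ((e.2.take (t : ℕ)).foldl (fun v b => μ b v) e.1.1, e.1.2)))
      ?_ ?_
    · intro e he
      rw [Finset.mem_coe, hB₁, Finset.mem_filter, Finset.mem_product] at he
      rw [Finset.mem_coe, Finset.mem_product, Finset.mem_product]
      exact ⟨he.1.2, he.2, Finset.mem_univ _⟩
    · intro e₁ _ e₂ _ h
      simp only [Prod.mk.injEq] at h
      obtain ⟨hg, hx, hy⟩ := h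
      rw [hg] at hx
      exact Prod.ext (Prod.ext (Supply.foldl_act_injective μ hμ _ hx) hy) hg
  have hB₂card : ∀ t, (B₂ t).card ≤ 2 ^ k * (R.card * n) := by
    intro t
    rw [← hc]
    refine Finset.card_le_card_of_injOn (fun e => (e.2, ((e.2.take (t : ℕ)).foldl (fun v b => μ b v) e.1.2, e.1.1)))
      ?_ ?_
    · intro e he
      rw [Finset.mem_coe, hB₂, Finset.mem_filter, Finset.mem_product] at he
      rw [Finset.mem_coe, Finset.mem_product, Finset.mem_product]
      exact ⟨he.1.2, he.2, Finset.mem_univ _⟩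
    · intro e₁ _ e₂ _ h
      simp only [Prod.mk.injEq] at h
      obtain ⟨hg, hy, hx⟩ := h
      rw [hg] at hy
      exact Prod.ext (Prod.ext hx (Supply.foldl_act_injective μ hμ _ hy)) hg
  have hU : ∀ B : Fin (k + 1) → Finset ((Fin n × Fin n) × List (Fin 3)), (∀ t, (B t).card ≤ 2 ^ k * (R.card * n)) →
      ((Finset.univ : Finset (Fin (k + 1))).biUnion B).card ≤ (k + 1) * (2 ^ k * (R.card * n)) := by
    intro B hB
    refine Finset.card_biUnion_le.trans ?_
    have := Finset.sum_le_sum (fun t (_ : t ∈ (Finset.univ : Finset (Fin (k + 1)))) => hB t)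
    rwa [Finset.sum_const, Finset.card_univ, Fintype.card_fin, smul_eq_mul] at this
  rw [← hPW]
  refine (Finset.card_le_card hcover).trans ((Finset.card_union_le _ _).trans ?_)
  refine Nat.add_le_add_left ((Finset.card_union_le _ _).trans ?_) _
  have h1 := hU B₁ hB₁card
  have h2 := hU B₂ hB₂card
  omega

/-! ### Extracting a scale -/

/-- `Σ_{j<K} 3^j 4^(K-j) + 4 · 3^K = 4 · 4^K`. [folklore] -/
theorem sum_three_four (K : ℕ) : ∑ j ∈ Finset.range K, 3 ^ j * 4 ^ (K - j) + 4 * 3 ^ K = 4 * 4 ^ K := by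
  induction K with
  | zero => simp
  | succ K ih =>
    rw [Finset.sum_range_succ, Nat.add_sub_cancel_left, pow_one]
    have h : ∑ j ∈ Finset.range K, 3 ^ j * 4 ^ (K + 1 - j) = 4 * ∑ j ∈ Finset.range K, 3 ^ j * 4 ^ (K - j) := by
      rw [Finset.mul_sum]
      refine Finset.sum_congr rfl (fun j hj => ?_)
      rw [Nat.sub_add_comm (Finset.mem_range.1 hj).le, pow_succ]; ring
    rw [h, pow_succ 3 K, pow_succ 4 K]
    linarith [ih]

/-- The weights of the double sum: `Σ_{i<k} Σ_{j<k-i} 3^i 3^j 4^(k-i-j) ≤ 16 · 4^k`. [folklore] -/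
theorem double_sum_le (k : ℕ) :
    ∑ i ∈ Finset.range k, ∑ j ∈ Finset.range (k - i), 3 ^ i * (3 ^ j * 4 ^ (k - i - j)) ≤ 16 * 4 ^ k := by
  have inner : ∀ i ∈ Finset.range k,
      ∑ j ∈ Finset.range (k - i), 3 ^ i * (3 ^ j * 4 ^ (k - i - j)) ≤ 3 ^ i * (4 * 4 ^ (k - i)) := by
    intro i _
    rw [← Finset.mul_sum]
    refine Nat.mul_le_mul_left _ ?_
    have := sum_three_four (k - i)
    omega
  refine (Finset.sum_le_sum inner).trans ?_
  have h2 : ∑ i ∈ Finset.range k, 3 ^ i * (4 * 4 ^ (k - i)) = 4 * ∑ i ∈ Finset.range k, 3 ^ i * 4 ^ (k - i) := by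
    rw [Finset.mul_sum]; refine Finset.sum_congr rfl (fun i _ => ?_); ring
  rw [h2]
  have := sum_three_four k
  omega

/-- **Twin supply at some scale, `R`-free** (the counting twin supply of crux NOTES §§2, 11, 12.3, with the forbidden set built
in).  If `2 ≤ n`, `8 n² ≤ 2^k` and `8 (k+1) |R| ≤ n`, then for some `1 ≤ m ≤ k` the number `TP_R(2m)` of triples `(z, p, q)` —
`z` cyclically reduced of length `2m`, `p ≠ q` both fixed by `z`, both `z`-trajectories avoiding `R` — is at least `4^m / 128`.
Proof: `card_based_le` gives `|D| ≥ n(n-1) 2^k / 2 ≥ 4 (n(n-1))²`, so `twinPairSupply_raw` yields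
`Σ_{i,j} 3^i 3^j TP_R(2(k-i-j)) ≥ (3/16) 4^k`, and if every `TP_R(2m)` were `< 4^m/128` the weights `double_sum_le` would bound the
same sum by `16 · 4^k / 128`. [folklore; this line] -/
theorem twinPairSupply (n k : ℕ) (μ : Fin 3 → Equiv.Perm (Fin n)) (R : Finset (Fin n))
    (hμ : ∀ b, μ b * μ b = 1) (hn : 2 ≤ n) (hk : 8 * (n * n) ≤ 2 ^ k) (hR : 8 * ((k + 1) * R.card) ≤ n) :
    ∃ m, 1 ≤ m ∧ m ≤ k ∧ 4 ^ m ≤ 128 *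
      (((((Finset.univ : Finset (List.Vector (Fin 3) (2 * m))).image (fun v => v.toList)).filter
          (fun z => List.IsChain (· ≠ ·) (z ++ z))) ×ˢ (Finset.univ : Finset (Fin n)).offDiag).filter
        (fun e => e.1.foldl (fun v b => μ b v) e.2.1 = e.2.1 ∧ e.1.foldl (fun v b => μ b v) e.2.2 = e.2.2 ∧
          (∀ t : Fin (2 * m + 1), (e.1.take (t : ℕ)).foldl (fun v b => μ b v) e.2.1 ∉ R) ∧
          (∀ t : Fin (2 * m + 1), (e.1.take (t : ℕ)).foldl (fun v b => μ b v) e.2.2 ∉ R))).card := by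
  -- abbreviations: `TP m` = number of `R`-free twin pre-pairs of length `2m`, `d` = `|D|`, `S` = the weighted sum
  set TP : ℕ → ℕ := fun m => (((((Finset.univ : Finset (List.Vector (Fin 3) (2 * m))).image (fun v => v.toList)).filter
          (fun z => List.IsChain (· ≠ ·) (z ++ z))) ×ˢ (Finset.univ : Finset (Fin n)).offDiag).filter
        (fun e => e.1.foldl (fun v b => μ b v) e.2.1 = e.2.1 ∧ e.1.foldl (fun v b => μ b v) e.2.2 = e.2.2 ∧
          (∀ t : Fin (2 * m + 1), (e.1.take (t : ℕ)).foldl (fun v b => μ b v) e.2.1 ∉ R) ∧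
          (∀ t : Fin (2 * m + 1), (e.1.take (t : ℕ)).foldl (fun v b => μ b v) e.2.2 ∉ R))).card with hTP
  by_contra hcon
  simp only [not_exists, not_and, not_le] at hcon
  have hsmall : ∀ m, 1 ≤ m → m ≤ k → 128 * TP m + 1 ≤ 4 ^ m := fun m h1 h2 => hcon m h1 h2
  set d := (((Finset.univ : Finset (Fin n)).offDiag ×ˢ
        (((Finset.univ : Finset (List.Vector (Fin 3) k)).image (fun v => v.toList)).filter
          (fun g => List.IsChain (· ≠ ·) g ∧ g.head? ≠ some (0 : Fin 3)))).filter
        (fun e => (∀ t : Fin (k + 1), (e.2.take (t : ℕ)).foldl (fun v b => μ b v) e.1.1 ∉ R) ∧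
          (∀ t : Fin (k + 1), (e.2.take (t : ℕ)).foldl (fun v b => μ b v) e.1.2 ∉ R))).card with hd
  set S := ∑ i ∈ Finset.range k, ∑ j ∈ Finset.range (k - i), 3 ^ i * (3 ^ j * TP (k - i - j)) with hS
  set N := n * n - n with hN
  have h1 : d ^ 2 ≤ (N * N) * (d + S) := twinPairSupply_raw n k μ 0 R hμ
  have h2 : N * 2 ^ k ≤ d + 2 * ((k + 1) * (2 ^ k * (R.card * n))) := card_based_le n k μ 0 R hμ
  -- (1) the weighted sum is small: `128 S + k ≤ 16 · 4^k`
  have hk1 : 1 ≤ k := by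
    rcases Nat.eq_zero_or_pos k with rfl | hk0
    · have : 4 ≤ n * n := Nat.mul_le_mul hn hn
      rw [pow_zero] at hk
      omega
    · exact hk0
  have hterm : ∀ i ∈ Finset.range k, ∀ j ∈ Finset.range (k - i),
      128 * (3 ^ i * (3 ^ j * TP (k - i - j))) + 1 ≤ 3 ^ i * (3 ^ j * 4 ^ (k - i - j)) := by
    intro i hi j hj
    have hi' := Finset.mem_range.1 hi
    have hj' := Finset.mem_range.1 hj
    have h := hsmall (k - i - j) (by omega) (by omega)
    have h3 : 1 ≤ 3 ^ i * 3 ^ j := Nat.one_le_iff_ne_zero.2 (by positivity)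
    have h4 := Nat.mul_le_mul_left (3 ^ i * 3 ^ j) h
    nlinarith [h4, h3]
  have hsum : 128 * S + k ≤ 16 * 4 ^ k := by
    refine le_trans ?_ (double_sum_le k)
    have step : ∀ i ∈ Finset.range k, 128 * (∑ j ∈ Finset.range (k - i), 3 ^ i * (3 ^ j * TP (k - i - j))) + 1 ≤
        ∑ j ∈ Finset.range (k - i), 3 ^ i * (3 ^ j * 4 ^ (k - i - j)) := by
      intro i hi
      have hi' := Finset.mem_range.1 hi
      calc 128 * (∑ j ∈ Finset.range (k - i), 3 ^ i * (3 ^ j * TP (k - i - j))) + 1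
          ≤ ∑ j ∈ Finset.range (k - i), (128 * (3 ^ i * (3 ^ j * TP (k - i - j))) + 1) := by
            rw [Finset.mul_sum, Finset.sum_add_distrib, Finset.sum_const, smul_eq_mul, mul_one, Finset.card_range]
            omega
        _ ≤ ∑ j ∈ Finset.range (k - i), 3 ^ i * (3 ^ j * 4 ^ (k - i - j)) := Finset.sum_le_sum (hterm i hi)
    calc 128 * S + k
        = ∑ i ∈ Finset.range k, (128 * (∑ j ∈ Finset.range (k - i), 3 ^ i * (3 ^ j * TP (k - i - j))) + 1) := by
          rw [hS, Finset.mul_sum, Finset.sum_add_distrib, Finset.sum_const, smul_eq_mul, mul_one, Finset.card_range]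
      _ ≤ _ := Finset.sum_le_sum step
  -- (2) the domain is large: `2 d ≥ N 2^k`, hence `d ≥ 4 N²`
  have hNle : N ≤ n * n := Nat.sub_le _ _
  have hNn : n ≤ N := by
    have : n * 2 ≤ n * n := Nat.mul_le_mul_left n hn
    omega
  have hE : 2 * (2 * ((k + 1) * (2 ^ k * (R.card * n)))) ≤ N * 2 ^ k := by
    have h4 : 4 * ((k + 1) * R.card) ≤ n - 1 := by omega
    have h5 : 4 * ((k + 1) * R.card) * n ≤ (n - 1) * n := Nat.mul_le_mul_right n h4
    have h6 : (n - 1) * n = N := by rw [hN, Nat.sub_mul, one_mul]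
    calc 2 * (2 * ((k + 1) * (2 ^ k * (R.card * n)))) = (4 * ((k + 1) * R.card) * n) * 2 ^ k := by ring
      _ ≤ ((n - 1) * n) * 2 ^ k := Nat.mul_le_mul_right _ h5
      _ = N * 2 ^ k := by rw [h6]
  have hd2 : N * 2 ^ k ≤ 2 * d := by omega
  have h7 : N * (8 * (n * n)) ≤ N * 2 ^ k := Nat.mul_le_mul_left N hk
  have h8 : N * N ≤ N * (n * n) := Nat.mul_le_mul_left N hNle
  have hd4 : 4 * (N * N) ≤ d := by linarith [hd2, h7, h8]
  -- (3) combine with Cauchy–Schwarz: `16 S ≥ 3 · 4^k`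
  have h9 : d * d ≤ N * N * d + N * N * S := by nlinarith [h1]
  have h10 : 4 * (N * N) * d ≤ d * d := Nat.mul_le_mul_right d hd4
  have h11 : 3 * (d * d) ≤ 4 * (N * N * S) := by linarith [h9, h10]
  have h12 : N * 2 ^ k * (N * 2 ^ k) ≤ 2 * d * (2 * d) := Nat.mul_le_mul hd2 hd2
  have h13 : N * N * (3 * (2 ^ k * 2 ^ k)) ≤ N * N * (16 * S) := by nlinarith [h11, h12]
  have hNpos : 0 < N * N := by
    have : 0 < N := by omega
    exact Nat.mul_pos this this
  have h14 : 3 * (2 ^ k * 2 ^ k) ≤ 16 * S := Nat.le_of_mul_le_mul_left h13 hNpos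
  have h4k : (4 : ℕ) ^ k = 2 ^ k * 2 ^ k := by
    rw [show (4 : ℕ) = 2 * 2 by norm_num, mul_pow]
  have hX : 1 ≤ 2 ^ k * 2 ^ k := Nat.one_le_iff_ne_zero.2 (by positivity)
  rw [h4k] at hsum
  omega

/-- **Registered form** (`stub_twinPairSupply`, a `--supports` sub-goal of crux `stmt-MatrixMultiplication-10883`):
`twinPairSupply`, fully quantified. -/
theorem stub_twinPairSupply : ∀ (n k : ℕ) (μ : Fin 3 → Equiv.Perm (Fin n)) (R : Finset (Fin n)), (∀ b, μ b * μ b = 1) → 2 ≤ n → 8 * (n * n) ≤ 2 ^ k → 8 * ((k + 1) * R.card) ≤ n → ∃ m, 1 ≤ m ∧ m ≤ k ∧ 4 ^ m ≤ 128 * (((((Finset.univ : Finset (List.Vector (Fin 3) (2 * m))).image (fun v => v.toList)).filter (fun z => List.IsChain (· ≠ ·) (z ++ z))) ×ˢ (Finset.univ : Finset (Fin n)).offDiag).filter (fun e => e.1.foldl (fun v b => μ b v) e.2.1 = e.2.1 ∧ e.1.foldl (fun v b => μ b v) e.2.2 = e.2.2 ∧ (∀ t : Fin (2 * m + 1), (e.1.take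 (t : ℕ)).foldl (fun v b => μ b v) e.2.1 ∉ R) ∧ (∀ t : Fin (2 * m + 1), (e.1.take (t : ℕ)).foldl (fun v b => μ b v) e.2.2 ∉ R))).card :=
  fun n k μ R hμ hn hk hR => twinPairSupply n k μ R hμ hn hk hR

end Summit.MatrixMultiplication.MatrixMultiplication.Theorems.HyperoctahedralThreshold.TwinPairSupply
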